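import Summits.Parity.BatemanHorn.Theses.RoughParitySectors

/-!
# `OddSectorShareNonlinear` (crux stmt-Parity-15628): `pairwise_not_associated` is load-bearing,
# modulo ONE odd rough value

Negative-side load-bearing analysis of the crux
`Summit.Parity.BatemanHorn.Theses.RoughParitySectors.OddSectorShareNonlinear`, continued (see
`LoadBearingHypotheses.lean` for `irreducible`, whose removal makes the statement FALSE outright,
witness `(X³)`).  The crux quantifies over Bateman–Horn systems `f` (`IsBatemanHornSystem f`:
irreducible, positive leading coefficients, PAIRWISE NON-ASSOCIATED, no fixed prime divisor) with a
member of degree `≥ 2`, and asserts `|c₁(x,U)·(U e^{−γ}/2)^k − c_odd(x,U)| ≤ η·c_odd(x,U)` for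
`U ≥ U₀(η)`, eventually in `x` (conclusion copied VERBATIM below).

* `oddSectorShareNonlinear_false_without_pairwise_not_associated_of_oddRoughValues`: with
  `pairwise_not_associated` DROPPED (the other three fields and the degree hypothesis kept), the
  statement is false AS SOON AS the following hypothesis `H` holds — some Bunyakovsky polynomial `g`
  (irreducible, positive leading coefficient, no fixed prime divisor) of degree `≥ 2` has, at
  arbitrarily large depth `U`, for infinitely many `x`, a value `g(n)` (`1 ≤ n ≤ x`) free of primes
  `< ⌈x^{deg g/U}⌉` with an ODD number of prime factors.  Mechanism (the DUPLICATED system `(g, g)`):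
  its jointly rough set, prime cell and all-odd sector are those of `(g)`, so the statement at
  `k = 1` gives `c₁·A = c_odd·(1 ± ½)` and at `k = 2` gives `c₁·A² = c_odd·(1 ± ½)` with
  `A = U e^{−γ}/2 ≥ U/4 > 3`; together `c₁A(A − 3) ≤ 0`, forcing `c₁ = c_odd = 0` at every large
  `x` — contradicted by one odd rough value.
* `oddRoughValues_of_frequently_prime`: `H` for `g` follows from "g takes prime values at
  infinitely many `n`" (qualitative Bunyakovsky for ONE polynomial of degree `≥ 2`, e.g. Landau's
  `n² + 1`; open) — so `H` is at most that strong; it also follows from a single Liouville sign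
  `λ(g(n)) = −1` on the `x^{deg g/U}`-rough values for infinitely many `x`.  `H` is not known for any
  `g` (a parity statement on a sifted set), which is why this is a negative lemma MODULO `H` and not a
  refutation of the hypothesis-dropped statement.

So both distinctness hypotheses of `IsBatemanHornSystem` are load-bearing for the crux: `irreducible`
unconditionally, `pairwise_not_associated` modulo `H`; the remaining two (`leadingCoeff_pos`,
`hasNoFixedPrimeDivisor`) only make instances vacuous when dropped (empty rough sets).
-/

namespace Summit.Parity.BatemanHorn.Theorems.OddSectorShareNonlinear.Negative

open Filter Finset Polynomial Real
open scoped Topology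
open Literature.NumberTheory.Sieve

/-- `e^{−γ} ≥ 1/2` (from `γ < 2/3 < log 2`). [folklore] -/
theorem one_half_le_exp_neg_eulerMascheroni :
    (1 : ℝ) / 2 ≤ Real.exp (-Real.eulerMascheroniConstant) := by
  have h1 : Real.eulerMascheroniConstant < 2 / 3 := Real.eulerMascheroniConstant_lt_two_thirds
  have h2 : (2 : ℝ) / 3 < Real.log 2 := by have := Real.log_two_gt_d9; linarith
  have h3 : Real.exp (-(Real.log 2)) ≤ Real.exp (-Real.eulerMascheroniConstant) :=
    Real.exp_le_exp.2 (by linarith)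
  rwa [Real.exp_neg, Real.exp_log two_pos, inv_eq_one_div] at h3

/-- For a prime `p`, the duplicated system `(g, g)` has the local root count of `(g)`:
`#{n < p : p ∣ g(n)²} = #{n < p : p ∣ g(n)}`. [folklore] -/
theorem polyRootCountMod_pair_self (g : ℤ[X]) {p : ℕ} (hp : p.Prime) :
    polyRootCountMod ![g, g] p = polyRootCountMod ![g] p := by
  unfold polyRootCountMod
  congr 1
  refine filter_congr fun n _ => ?_
  simp only [Fin.prod_univ_two, Fin.prod_univ_one, Matrix.cons_val_zero, Matrix.cons_val_one]
  exact ⟨fun h => ((Nat.prime_iff_prime_int.1 hp).dvd_mul.1 h).elim id id, fun h => h.mul_left _⟩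

/-- `(g, g)` has no fixed prime divisor iff... — the direction used: if `(g)` has none, neither has
`(g, g)`. [folklore] -/
theorem hasNoFixedPrimeDivisor_pair_self {g : ℤ[X]} (hg : HasNoFixedPrimeDivisor ![g]) :
    HasNoFixedPrimeDivisor ![g, g] := fun p hp => by
  rw [polyRootCountMod_pair_self g hp]; exact hg p hp

/-- **`pairwise_not_associated` is load-bearing, modulo one odd rough value.**  Suppose `H`: some
`g ∈ ℤ[X]`, irreducible with positive leading coefficient, no fixed prime divisor and `deg g ≥ 2`,
has, for every `U₀`, a depth `U ≥ U₀` at which, for infinitely many `x`, some `1 ≤ n ≤ x` has `g(n)`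
free of primes `< ⌈x^{deg g/U}⌉` with `Ω(g(n))` odd.  Then the crux `OddSectorShareNonlinear` with
the field `pairwise_not_associated` of `IsBatemanHornSystem` DROPPED (conclusion verbatim) is false:
the duplicated system `(g, g)` and the system `(g)` have the same rough set and cells, and the two
instances `k = 1, 2` (`η = 1/2`) force `A = U e^{−γ}/2 ≤ 3`, absurd for `U ≥ 13`. [folklore] -/
theorem oddSectorShareNonlinear_false_without_pairwise_not_associated_of_oddRoughValues :
    (∃ g : ℤ[X], Irreducible g ∧ 0 < g.leadingCoeff ∧ HasNoFixedPrimeDivisor ![g] ∧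
      2 ≤ g.natDegree ∧ ∀ U₀ : ℝ, ∃ U : ℝ, U₀ ≤ U ∧ ∃ᶠ x : ℕ in atTop,
        0 < #(((Icc 1 x).filter (fun n : ℕ => 0 < g.eval (n : ℤ) ∧
          ∀ p ∈ range ⌈(x : ℝ) ^ ((g.natDegree : ℝ) / U)⌉₊, p.Prime →
            ¬ ((p : ℤ) ∣ g.eval (n : ℤ)))).filter (fun n : ℕ =>
          Odd (ArithmeticFunction.cardFactors ((g.eval (n : ℤ)).toNat))))) →
    ¬ ∀ (k : ℕ) (f : Fin k → ℤ[X]), (∀ i, Irreducible (f i)) → (∀ i, 0 < (f i).leadingCoeff) →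
      HasNoFixedPrimeDivisor f →
        (∃ i, 2 ≤ (f i).natDegree) → ∀ η : ℝ, 0 < η → ∃ U₀ : ℝ, ∀ U : ℝ, U₀ ≤ U → ∀ᶠ x : ℕ in atTop,
          |(((((Icc 1 x).filter (fun n : ℕ => ∀ i, 0 < (f i).eval (n : ℤ) ∧
              ∀ p ∈ range ⌈(x : ℝ) ^ (((f i).natDegree : ℝ) / U)⌉₊, p.Prime →
                ¬ ((p : ℤ) ∣ (f i).eval (n : ℤ)))).filter (fun n : ℕ => ∀ i,
              ArithmeticFunction.cardFactors (((f i).eval (n : ℤ)).toNat) = 1)).card : ℕ) : ℝ) *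
              (U * Real.exp (-Real.eulerMascheroniConstant) / 2) ^ k -
            (((((Icc 1 x).filter (fun n : ℕ => ∀ i, 0 < (f i).eval (n : ℤ) ∧
              ∀ p ∈ range ⌈(x : ℝ) ^ (((f i).natDegree : ℝ) / U)⌉₊, p.Prime →
                ¬ ((p : ℤ) ∣ (f i).eval (n : ℤ)))).filter (fun n : ℕ => ∀ i,
              Odd (ArithmeticFunction.cardFactors (((f i).eval (n : ℤ)).toNat)))).card : ℕ) : ℝ)| ≤
            η * (((((Icc 1 x).filter (fun n : ℕ => ∀ i, 0 < (f i).eval (n : ℤ) ∧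
              ∀ p ∈ range ⌈(x : ℝ) ^ (((f i).natDegree : ℝ) / U)⌉₊, p.Prime →
                ¬ ((p : ℤ) ∣ (f i).eval (n : ℤ)))).filter (fun n : ℕ => ∀ i,
              Odd (ArithmeticFunction.cardFactors (((f i).eval (n : ℤ)).toNat)))).card : ℕ) :
                ℝ) := by
  intro H h
  obtain ⟨g, hirr, hlc, hnfd, hdeg, hH⟩ := H
  -- the two instances: `(g)` and the duplicated system `(g, g)`
  have hirr1 : ∀ i, Irreducible (![g] i) := fun i => by fin_cases i; simpa using hirr
  have hlc1 : ∀ i, 0 < (![g] i).leadingCoeff := fun i => by fin_cases i; simpa using hlc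
  have hdeg1 : ∃ i, 2 ≤ (![g] i).natDegree := ⟨0, by simpa using hdeg⟩
  have hirr2 : ∀ i, Irreducible (![g, g] i) := fun i => by fin_cases i <;> simpa using hirr
  have hlc2 : ∀ i, 0 < (![g, g] i).leadingCoeff := fun i => by fin_cases i <;> simpa using hlc
  have hdeg2 : ∃ i, 2 ≤ (![g, g] i).natDegree := ⟨0, by simpa using hdeg⟩
  obtain ⟨U₁, hU₁⟩ := h 1 ![g] hirr1 hlc1 hnfd hdeg1 (1 / 2) one_half_pos
  obtain ⟨U₂, hU₂⟩ := h 2 ![g, g] hirr2 hlc2 (hasNoFixedPrimeDivisor_pair_self hnfd) hdeg2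
    (1 / 2) one_half_pos
  obtain ⟨U, hU, hfreq⟩ := hH (max (max U₁ U₂) 13)
  have hU1 : U₁ ≤ U := le_trans (le_trans (le_max_left _ _) (le_max_left _ _)) hU
  have hU2 : U₂ ≤ U := le_trans (le_trans (le_max_right _ _) (le_max_left _ _)) hU
  have hU13 : (13 : ℝ) ≤ U := le_trans (le_max_right _ _) hU
  obtain ⟨x, hpos, h1, h2⟩ := (hfreq.and_eventually ((hU₁ U hU1).and (hU₂ U hU2))).exists
  -- the rough sets and cells of `(g)` and `(g, g)` are those of `g`
  simp only [Fin.forall_fin_one, Fin.forall_fin_two, Matrix.cons_val_zero, Matrix.cons_val_one,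
    and_self] at h1 h2
  set A : ℝ := U * Real.exp (-Real.eulerMascheroniConstant) / 2 with hA
  set c₁ : ℝ := ((#(((Icc 1 x).filter (fun n : ℕ => 0 < g.eval (n : ℤ) ∧
      ∀ p ∈ range ⌈(x : ℝ) ^ ((g.natDegree : ℝ) / U)⌉₊, p.Prime →
        ¬ ((p : ℤ) ∣ g.eval (n : ℤ)))).filter (fun n : ℕ =>
      ArithmeticFunction.cardFactors ((g.eval (n : ℤ)).toNat) = 1)) : ℕ) : ℝ) with hc₁
  set co : ℝ := ((#(((Icc 1 x).filter (fun n : ℕ => 0 < g.eval (n : ℤ) ∧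
      ∀ p ∈ range ⌈(x : ℝ) ^ ((g.natDegree : ℝ) / U)⌉₊, p.Prime →
        ¬ ((p : ℤ) ∣ g.eval (n : ℤ)))).filter (fun n : ℕ =>
      Odd (ArithmeticFunction.cardFactors ((g.eval (n : ℤ)).toNat)))) : ℕ) : ℝ) with hco
  have hco0 : 0 < co := by rw [hco]; exact_mod_cast hpos
  have hc₁0 : 0 ≤ c₁ := Nat.cast_nonneg _
  have hA3 : 3 < A := by
    have hγ := one_half_le_exp_neg_eulerMascheroni
    rw [hA]
    nlinarith [mul_le_mul_of_nonneg_left hγ (by linarith : (0 : ℝ) ≤ U)]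
  -- `k = 1`: `c₁ A ≥ co/2`, `c₁ A ≤ 3co/2`; `k = 2`: `c₁ A² ≤ 3co/2`
  rw [pow_one] at h1
  obtain ⟨h1a, h1b⟩ := abs_le.1 h1
  obtain ⟨-, h2b⟩ := abs_le.1 h2
  have hcA : co / 2 ≤ c₁ * A := by linarith
  have hcA2 : c₁ * A ^ 2 ≤ 3 * (c₁ * A) := by nlinarith
  -- `c₁ A (A - 3) ≤ 0` with `c₁ A > 0`, so `A ≤ 3`: contradiction
  have hcApos : 0 < c₁ * A := by linarith
  have : c₁ * A * (A - 3) ≤ 0 := by nlinarith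
  nlinarith [mul_pos hcApos (sub_pos.2 hA3)]

/-- **`H` is at most "one polynomial of degree `≥ 2` takes infinitely many prime values".**  If
`g ∈ ℤ[X]` with positive leading coefficient and `deg g ≥ 2` has `g(n)` prime for infinitely many
`n`, then for every `U₀` there is `U ≥ U₀` (namely `max U₀ (deg g)`) such that for infinitely many
`x` the `x^{deg g/U}`-rough values of `g` on `[1, x]` contain one with `Ω` odd (the prime `g(x)`
itself: `Ω = 1`, and `g(x) ≥ x ≥ ⌈x^{deg g/U}⌉` is above the sifting threshold). [folklore] -/
theorem oddRoughValues_of_frequently_prime {g : ℤ[X]} (hlc : 0 < g.leadingCoeff)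
    (hdeg : 2 ≤ g.natDegree)
    (hprime : ∃ᶠ n : ℕ in atTop, 0 < g.eval (n : ℤ) ∧ ((g.eval (n : ℤ)).toNat).Prime) :
    ∀ U₀ : ℝ, ∃ U : ℝ, U₀ ≤ U ∧ ∃ᶠ x : ℕ in atTop,
      0 < #(((Icc 1 x).filter (fun n : ℕ => 0 < g.eval (n : ℤ) ∧
        ∀ p ∈ range ⌈(x : ℝ) ^ ((g.natDegree : ℝ) / U)⌉₊, p.Prime →
          ¬ ((p : ℤ) ∣ g.eval (n : ℤ)))).filter (fun n : ℕ =>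
        Odd (ArithmeticFunction.cardFactors ((g.eval (n : ℤ)).toNat)))) := by
  intro U₀
  refine ⟨max U₀ g.natDegree, le_max_left _ _, ?_⟩
  set U : ℝ := max U₀ g.natDegree with hU
  have hUd : (g.natDegree : ℝ) ≤ U := le_max_right _ _
  have hd0 : (0 : ℝ) < g.natDegree := by exact_mod_cast (by omega : 0 < g.natDegree)
  have hU0 : 0 < U := lt_of_lt_of_le hd0 hUd
  obtain ⟨M, hM⟩ :=
    Summit.Parity.BatemanHorn.Theorems.BalancedSemiprimeLayer.Negative.exists_pow_le_two_mul_eval hlc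
  refine (hprime.and_eventually (eventually_ge_atTop (max M 2))).mono fun x ⟨⟨hgx, hpx⟩, hxM⟩ => ?_
  have hxM' : M ≤ x := le_trans (le_max_left _ _) hxM
  have hx2 : 2 ≤ x := le_trans (le_max_right _ _) hxM
  -- `x ≤ g(x)`: from `x^d ≤ 2 g(x)`, `d ≥ 2`, `x ≥ 2`
  have hgrow := hM x hxM'
  have hxg : (x : ℤ) ≤ g.eval (x : ℤ) := by
    have hx2' : (2 : ℤ) ≤ x := by exact_mod_cast hx2
    have hpow : (x : ℤ) * x ≤ (x : ℤ) ^ g.natDegree := by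
      calc (x : ℤ) * x = (x : ℤ) ^ 2 := by ring
        _ ≤ (x : ℤ) ^ g.natDegree := pow_le_pow_right₀ (by linarith) hdeg
    nlinarith
  refine card_pos.2 ⟨x, ?_⟩
  rw [mem_filter, mem_filter, mem_Icc]
  refine ⟨⟨⟨by omega, le_rfl⟩, hgx, fun p hp hpp hdvd => ?_⟩, ?_⟩
  · -- a prime `p < ⌈x^{d/U}⌉ ≤ x` dividing the prime `g(x) ≥ x`: impossible
    rw [mem_range, Nat.lt_ceil] at hp
    have hx1 : (1 : ℝ) ≤ x := by exact_mod_cast (show 1 ≤ x by omega)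
    have hpx' : (p : ℝ) < x := by
      calc (p : ℝ) < (x : ℝ) ^ ((g.natDegree : ℝ) / U) := hp
        _ ≤ (x : ℝ) ^ (1 : ℝ) :=
            Real.rpow_le_rpow_of_exponent_le hx1 ((div_le_one hU0).2 hUd)
        _ = x := Real.rpow_one _
    have hpn : p ∣ (g.eval (x : ℤ)).toNat := by
      rw [← Int.natCast_dvd_natCast, Int.toNat_of_nonneg hgx.le]; exact hdvd
    have hpeq : p = (g.eval (x : ℤ)).toNat := (Nat.prime_dvd_prime_iff_eq hpp hpx).1 hpn
    have : (x : ℤ) ≤ p := by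
      rw [hpeq, Int.toNat_of_nonneg hgx.le]; exact hxg
    have : (x : ℝ) ≤ p := by exact_mod_cast this
    linarith
  · rw [ArithmeticFunction.cardFactors_apply_prime hpx]
    exact odd_one

end Summit.Parity.BatemanHorn.Theorems.OddSectorShareNonlinear.Negative
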